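import Literature.MathematicalPhysics.QuantumFieldTheory.Balaban1983to89.B8Ineq159TopCubeTowerReads
import Literature.MathematicalPhysics.QuantumFieldTheory.Balaban1983to89.B9SupplySockB9P3ZdGammaUnivDelta2
import Literature.MathematicalPhysics.QuantumFieldTheory.Balaban1983to89.B9SupplySockB9P3ZdSocketBoundaryMode
import Literature.MathematicalPhysics.QuantumFieldTheory.Balaban1983to89.B8Prop7GlevZd3

/-!
# `Balaban1983to89.B8SockB9P3H2AtTopCubeTower` — [Balaban1985RegularSpaces] (1.57)–(1.59) p. 86, (1.31) p. 82, (1.131) p. 99: THE b9-SOCKETS OF PROPOSITION 3's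
# FRAME (`SockB9P3H2`, `SockB9P3`) HOLD AT PRINT'S TOP-CUBE TOWER `(T, □₁, …, □_k)` WITH THE PRINTED CLASS `towerBondsP`, PER MEMBER — the positive twin of
# `B8SockB9P3ShellModeVacuityUniv.not_sockB9P3_of_topCube`

statement-level skeleton of published theorems with citation tags; proofs where landed; nothing here is a claim about the
Yang–Mills mass gap

`[Balaban1985RegularSpaces]` ("B8", CMP **99** (1985) 75–102) (1.36)–(1.38) p. 82, (1.40)–(1.42) p. 83, (1.55)–(1.59) p. 86, (1.7) p. 77, (1.31) p. 82, (1.131)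
p. 99; [4] = `[Balaban1985BackgroundPropagators]` Thm 3.3 p. 399 («the constants … depend on d and L only»), (3.40)–(3.47) pp. 397–398; [B6] =
`[Balaban1984PropagatorsII]` (2.3) p. 224.  PDF held: `paper:balaban1985-cmp99-regular-spaces-gauge-fixing`.

CITATION HEADER (lean-in-tree rule).  Cell `pub-ymgap` (YM Track A, HUMAN RULING D-0062 ∕ D-0149), node N05 = [B8], width seat `pub-ymgap-dag-n05-w3` (g4), CLAIM-1.
WHY.  The «P₂D» slot reads the in-edge b9 of N05 through the binder `SB9P : ∀ i, … → SockB9P3H2 θ.L B₀ B₀β cB9 β len i.η i.k i.Ω i.Λs (fun m j => towerBondsP θ.L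
i.Ω (i.Λs m) j)` (dag-n05-d `…N05SubBP2DSlotGammaPrime`); ref-A's WATCH-P2D-SLET-INHABITATION: no positive inhabitation of the (1.5)-keyed sockets shown.  dag-n05-c's
`not_sockB9P3_of_topCube` refuted `SockB9P3` at the top-cube tower `(T, □₁)` for the class law №12 `towerBonds` (no crossing bonds: the `∂□₁` shell mode) — the
origin of FLAG №4 and of the re-typing over print's (1.31) `towerBondsP`.  THIS FILE: with `towerBondsP` BOTH sockets HOLD at `(T, □₁, …, □_k)`, every position,
spacing and depth `k ≥ 1`, constants per member shape — from this lineage's per-member curved (1.59) (`B8Ineq159CurvedCubeMemberUniform`, file (U)).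

THE MATHEMATICS (kernel-checked).  `weight_mul_hquot_le`; the core ★★ `socketLines_topCube` (lines 1–4 of (1.59) + the weighted Hölder line over ANY pair class inside
the admissible pairs; the sockets' binders VERBATIM); ★★★ `exists_sockB9P3H2_topCube`, ★★★ `exists_sockB9P3_topCube` (by `exact` from the core).  PROOF ROAD: `Ω₀ = T`
makes `|A′| ≤ α₂(Lʲη)⁻¹` a GLOBAL bound; `cP ≤ 1∕2 < log 2` turns `IsLandau138W` into (1.38) for `A′` (`logCfg_cfgExp_of_small`); the reads file transfers it to the
cube member for the cut-off field `A′·𝟙_{sides touching □₀}`; the targets `N := |J|₍₋₃₎ + |B₁|` dominate file (U)'s hypotheses (`cubeLamBP ⊆ towerBondsP`); (U) gives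
`(Lʲη)|A′| ≤ B″N` on the sides of the plaquettes touching `□_j`, `j ≥ 1`; every other bond is a level-`0` bond of `towerBondsP`, where `|B₁|` reads `ηA′` itself — so
`η|A′| ≤ (B″+1)N` EVERYWHERE; lines 2, 4, 5 follow from that pointwise bound through the stencils, line 3 is `J = D^{η*}D^η A′` by definition.

HONEST SCOPE ∕ A6 — READ THIS.  (a) `B₀ = 4(d+1)(Lᵏ)³(B″+1)`, `B₀β = 4(Lᵏ)²(Lᵏ)^β(B″+1)`, `cP = min{α₀(□), 1∕2}` depend on the member SHAPE `(L, M, ρ, k)`, on `β`, `d`,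
`𝔹`, `len ≥ 1` (through (U)'s non-explicit `α₀(□), B″(□)`) — NOT on the position `a`, NOT on `η`.  This is the WEAK form (one member class, member-dependent constants)
of a positive inhabitation of `SB9P`: it certifies the socket TEXT (weights, classes, `InAk`∕`IsLandau138W`∕`cfgExp` hypotheses, Hölder pairs) at a NON-DEGENERATE
(1.5)-member with a curved small-field background, where FLAG №4 was raised.  (b) NOT the class-wide binder (ONE `B₀(d, L)` for all admissible `{Ω_j}` and depths = [4]
Thm 3.3 = N06's object layer, dag-n06-b's road); no letter of [4] assumed or proved; the socket hypotheses `InAk … (W·U₀)`, self-adjointness and «`A′ = 0` off» are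
idle here.  (c) Non-vacuity: `U₀ = W = 1`, `A′ = 0`.  Count-neutral; N05 NOT discharged; no count claim; one finite `𝕋⁴` programme at fixed `ε`, Bałaban as printed;
the YM mass gap (Clay) is NOT proved by any of this — R4 closes the conditional finite-`𝕋⁴` rung `BalabanLadder.UV` only; nothing continuum ∕ ℝ⁴ ∕ OS.  No `sorry`,
no `def`, no `instance`, no `notation`.  Unit `pub-ymgap-dag-n05-w3` (g4), 2026-08-28.
-/


noncomputable section

namespace Literature.MathematicalPhysics.QuantumFieldTheory.Balaban1983to89.B8SockB9P3H2AtTopCubeTower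

open B7Prop1Explicit B7Prop2Explicit B7Prop1Local B7Eq78Linearization
open B7Prop4GeneralLevels (linCovIter)
open B8Ineq132 (covDerivFwd covDeriv BondTouches PlaqTouches InAk)
open B8Eq140Level (SideTouches sideTouches_of_bondTouches sideTouches_mono)
open B8Eq146AExpansion (iEta plaqCovDeriv norm_I_eta_smul)
open B8Eq143PlaqExpansion (pdiv)
open B8Eq155JBound (Jcur Jcur_def wsup le_wsup wsup_nonneg)
open B8ScaledSupNorm (bondNorm msup weight Bdd msup_le msup_nonneg weight_mul_norm_le_msup weight_neg_natCast scale_pos)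
open B8Eq138LandauZd (IsLandau138 IsLandau138W covLap logCfg)
open B8Eq184Proof (cfgExp)
open B8Lemma1NonAbelian (mulCfg)
open B9Eq340HolderZd (hquot AdmPair trans norm_trans trans_self hquot_nonneg)
open B8Eq131CubesAdmissible (cubeFam cubeFam_true_zero cubeFam_false_zero cubeFam_false_of_le cubeFam_of_pos)
open B8Eq131Cubes (cube cube_anti)
open B8CubeMemberZd (cubeLamS)
open B8Ineq159FlatCubeMemberPrinted (cubeLamBP cubeLamBP_box_subset_pred)
open B8Ineq159FlatCubeMemberKernel (mem_cube_zero_iff)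
open B8TowerBondsPrinted (towerBondsP)
open B9Ineq3137LocalSup (linCovIter_congr)
open B9SupplySockB9P3ZdGammaUnivDelta2 (SockB9P3H2)
open B8LeafModelZd3 (SockB9P3)
open B9SupplySockB9P3ZdSocketBoundaryMode (logCfg_cfgExp_of_small exists_ne_fin)
open B8Ineq159CurvedCubeMemberUniform (exists_curved159_perCube_inAk_sup_unitary_uniform)
open B8Ineq159TopCubeTowerReads
open B8Prop7GlevZd3 (inAk_mono_alpha)

-- `Site` alone would resolve to the torus sites of `Setup.lean`; re-export the `ℤ^d` sites of `B7Prop1Explicit`.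
export B7Prop1Explicit (Site)

variable {d : ℕ} {𝔹 : Type*} [CStarAlgebra 𝔹] [Nontrivial 𝔹]

/-! ## §1 The weighted Hölder quotient from a pointwise derivative bound -/

/-- **The weighted both-points Hölder quotient of (3.40) from a pointwise bound** (per-member bookkeeping): if `η²‖F(z)‖ ≤ D` everywhere, `U₀` is `U1`-valued,
`len z ≥ 1` for `z ≠ 0`, `β ≥ 0`, then for `j ≤ k`: `(Lʲη)^{2+β}·hquot(F)(x, x′) ≤ 2L^{2k}(Lᵏ)^β·D` (transport `‖R(·)X‖ = ‖X‖`; `(η·len)^β ≥ η^β`; at `x′ = x`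
the quotient vanishes). [cite: Balaban1985BackgroundPropagators, (3.40) p.397, (3.47) p.398; Balaban1985RegularSpaces, (1.59) p.86] -/
theorem weight_mul_hquot_le {L : ℕ} (hL : 1 ≤ L) {η : ℝ} (hη : 0 < η) {β : ℝ} (hβ : 0 ≤ β) {len : Site d → ℝ}
    (hlen : ∀ z : Site d, z ≠ 0 → 1 ≤ len z) {U₀ : Site d → Fin d → 𝔹ˣ} (hU : ∀ x κ, U₀ x κ ∈ U1 𝔹) {F : Site d → 𝔹} {D : ℝ} (hD0 : 0 ≤ D)
    (hD : ∀ z, η ^ 2 * ‖F z‖ ≤ D) {k j : ℕ} (hj : j ≤ k) {x x' : Site d} (hp : (x, x') ∈ AdmPair η len) :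
    weight L η (-(2 + β)) j * ‖hquot η β len U₀ F (x, x')‖ ≤ 2 * ((L : ℝ) ^ k) ^ 2 * ((L : ℝ) ^ k) ^ β * D := by
  have hL1 : (1 : ℝ) ≤ L := by exact_mod_cast hL
  have hLk1 : (1 : ℝ) ≤ (L : ℝ) ^ k := one_le_pow₀ hL1
  have hLk0 : (0 : ℝ) ≤ (L : ℝ) ^ k := by positivity
  have hs : 0 < (L : ℝ) ^ j * η := scale_pos hL hη j
  have hsS : (L : ℝ) ^ j * η ≤ (L : ℝ) ^ k * η := mul_le_mul_of_nonneg_right (pow_le_pow_right₀ hL1 hj) hη.le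
  have hw : weight L η (-(2 + β)) j ≤ ((L : ℝ) ^ k) ^ 2 * η ^ 2 * (((L : ℝ) ^ k) ^ β * η ^ β) := by
    have e1 : weight L η (-(2 + β)) j = ((L : ℝ) ^ j * η) ^ 2 * ((L : ℝ) ^ j * η) ^ β := by
      rw [weight, neg_neg, Real.rpow_add hs, Real.rpow_two]
    rw [e1, ← mul_pow, ← Real.mul_rpow hLk0 hη.le]
    exact mul_le_mul (pow_le_pow_left₀ hs.le hsS 2) (Real.rpow_le_rpow hs.le hsS hβ) (Real.rpow_nonneg hs.le β) (by positivity)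
  have hq0 : 0 ≤ hquot η β len U₀ F (x, x') := hquot_nonneg hη.le β U₀ F hp
  rw [Real.norm_of_nonneg hq0]
  by_cases hxx : x' = x
  · -- the diagonal pair: the quotient vanishes
    have h0 : hquot η β len U₀ F (x, x') = 0 := by
      rw [hxx]; simp only [hquot, trans_self, sub_self, norm_zero, zero_div]
    rw [h0, mul_zero]; positivity
  · -- an honest pair: `len (x′ − x) ≥ 1`
    have hz : x' - x ≠ 0 := sub_ne_zero.mpr hxx
    have hl1 : 1 ≤ len (x' - x) := hlen _ hz
    have hden : η ^ β ≤ (η * len (x' - x)) ^ β :=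
      Real.rpow_le_rpow hη.le (by nlinarith) hβ
    have hηβ : 0 < η ^ β := Real.rpow_pos_of_pos hη β
    have hnum : ‖trans U₀ x x' (F x') - F x‖ ≤ ‖F x'‖ + ‖F x‖ :=
      (norm_sub_le _ _).trans (by rw [norm_trans hU])
    have hFz : ∀ z, ‖F z‖ ≤ D * (η ^ 2)⁻¹ := fun z => by
      rw [le_mul_inv_iff₀ (by positivity : (0 : ℝ) < η ^ 2), mul_comm]; exact hD z
    have hquot_le : hquot η β len U₀ F (x, x') ≤ (2 * D * (η ^ 2)⁻¹) * (η ^ β)⁻¹ := by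
      rw [hquot]
      calc ‖trans U₀ x x' (F x') - F x‖ / (η * len (x' - x)) ^ β ≤ (‖F x'‖ + ‖F x‖) / η ^ β :=
            div_le_div₀ (by positivity) hnum hηβ hden
        _ ≤ (2 * D * (η ^ 2)⁻¹) / η ^ β := by
            gcongr
            linarith [hFz x', hFz x]
        _ = (2 * D * (η ^ 2)⁻¹) * (η ^ β)⁻¹ := div_eq_mul_inv _ _
    calc weight L η (-(2 + β)) j * hquot η β len U₀ F (x, x')
        ≤ (((L : ℝ) ^ k) ^ 2 * η ^ 2 * (((L : ℝ) ^ k) ^ β * η ^ β)) * ((2 * D * (η ^ 2)⁻¹) * (η ^ β)⁻¹) :=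
          mul_le_mul hw hquot_le hq0 (by positivity)
      _ = 2 * ((L : ℝ) ^ k) ^ 2 * ((L : ℝ) ^ k) ^ β * D * ((η ^ 2 * (η ^ 2)⁻¹) * (η ^ β * (η ^ β)⁻¹)) := by ring
      _ = 2 * ((L : ℝ) ^ k) ^ 2 * ((L : ℝ) ^ k) ^ β * D := by
          rw [mul_inv_cancel₀ (by positivity), mul_inv_cancel₀ hηβ.ne', mul_one, mul_one]

/-! ## §2 The socket at the top-cube tower -/

/-- ★★ **THE FIVE LINES OF (1.59) AT PRINT'S TOP-CUBE TOWER, PER MEMBER, FOR ANY HÖLDER PAIR CLASS INSIDE THE ADMISSIBLE PAIRS** (the common core of the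
sockets `SockB9P3` of `B8LeafModelZd3` — Hölder pairs with the first point in `Ω_j` — and `SockB9P3H2` — both points in `Ω_j`): for `d ≥ 2`, `2 ≤ L ≤ ρ`,
`k ≥ 1`, `β ≥ 0`, `len z ≥ 1` (`z ≠ 0`), finite-dimensional `𝔹`, there are `B₀, B₀β, cP > 0` such that for every position `a`, spacing `η > 0`, restriction family of
print's shape, and every class `memH j ⊆ AdmPair η len` of pairs, the socket binders of Proposition 3's frame imply lines 1–4 of (1.59) and the weighted Hölder line
over `memH`.  The binder list is the sockets' VERBATIM (so both sockets follow by `exact`). [cite: Balaban1985RegularSpaces, (1.57)–(1.59) p.86, (1.38) p.82, (1.31) p.82, (1.131) p.99, (1.7) p.77; Balaban1985BackgroundPropagators, Thm 3.3 p.399, (3.40)–(3.47) pp.397–398; Balaban1984PropagatorsII, (2.3) p.224] -/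
theorem socketLines_topCube [FiniteDimensional ℂ 𝔹] (hd2 : 2 ≤ d) {L : ℕ} (hL2 : 2 ≤ L) (M : ℕ) {ρ : ℕ} (hρ : L ≤ ρ)
    {k : ℕ} (hk : 1 ≤ k) {β : ℝ} (hβ : 0 ≤ β) {len : Site d → ℝ} (hlen : ∀ z : Site d, z ≠ 0 → 1 ≤ len z) :
    ∃ B₀ B₀β cP : ℝ, 0 < B₀ ∧ 0 < B₀β ∧ 0 < cP ∧ ∀ (a : Site d) (η : ℝ), 0 < η →
      ∀ Λs : ℕ → ℕ → Set (Site d), Λs k 0 = (cube L a M ρ k 1)ᶜ → (∀ j, 1 ≤ j → j ≤ k → Λs k j = cubeLamS L a M ρ k k j) →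
      ∀ memH : ℕ → (Fin d × Fin d × (Site d × Site d)) → Prop, (∀ j q, memH j q → q.2.2 ∈ AdmPair η len) →
      ∀ α₀ α₂ : ℝ, 0 < α₀ → α₀ ≤ cP → 0 < α₂ → α₂ ≤ cP →
        ∀ (U₀ W : Site d → Fin d → 𝔹ˣ), (∀ x κ, U₀ x κ ∈ unitaryUnits 𝔹) → (∀ x κ, W x κ ∈ unitaryUnits 𝔹) →
        InAk L k η α₀ (cubeFam true L a M ρ k) U₀ → InAk L k η α₀ (cubeFam true L a M ρ k) (mulCfg W U₀) →
        IsLandau138W L k η (cubeFam true L a M ρ k 0) (Λs k) U₀ W →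
        ∀ A' : Site d → Fin d → 𝔹, (∀ y τ, IsSelfAdjoint (A' y τ)) →
        (∀ j, j ≤ k → ∀ (y : Site d) (τ : Fin d), SideTouches (cubeFam true L a M ρ k j) y τ →
          W y τ = cfgExp η A' y τ ∧ ‖A' y τ‖ ≤ α₂ * ((L : ℝ) ^ j * η)⁻¹) →
        (∀ (y : Site d) (τ : Fin d), (∀ j, j ≤ k → ¬ SideTouches (cubeFam true L a M ρ k j) y τ) → A' y τ = 0) →
        msup L k η (-(1 : ℝ)) (fun j (b : Site d × Fin d) => SideTouches (cubeFam true L a M ρ k j) b.1 b.2) (fun b => A' b.1 b.2)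
            ≤ B₀ * (bondNorm L k η (-(3 : ℝ)) (cubeFam true L a M ρ k) (fun x μ => Jcur η U₀ A' μ x)
              + wsup 1 (fun p : {p : ℕ × (Site d × Fin d) // p.1 ≤ k ∧ p.2 ∈ towerBondsP L (cubeFam true L a M ρ k) (Λs k) p.1} =>
                  linCovIter L U₀ (iEta η A') p.1.1 p.1.2.1 p.1.2.2)) ∧
          msup L k η (-(2 : ℝ)) (fun j (t : Fin d × Fin d × Site d) => SideTouches (cubeFam true L a M ρ k j) t.2.2 t.2.1)
              (fun t => covDerivFwd η U₀ t.1 (fun z => A' z t.2.1) t.2.2)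
            ≤ B₀ * (bondNorm L k η (-(3 : ℝ)) (cubeFam true L a M ρ k) (fun x μ => Jcur η U₀ A' μ x)
              + wsup 1 (fun p : {p : ℕ × (Site d × Fin d) // p.1 ≤ k ∧ p.2 ∈ towerBondsP L (cubeFam true L a M ρ k) (Λs k) p.1} =>
                  linCovIter L U₀ (iEta η A') p.1.1 p.1.2.1 p.1.2.2)) ∧
          bondNorm L k η (-(3 : ℝ)) (cubeFam true L a M ρ k) (fun x μ => pdiv η U₀ (plaqCovDeriv η U₀ A') μ x)
            ≤ B₀ * (bondNorm L k η (-(3 : ℝ)) (cubeFam true L a M ρ k) (fun x μ => Jcur η U₀ A' μ x)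
              + wsup 1 (fun p : {p : ℕ × (Site d × Fin d) // p.1 ≤ k ∧ p.2 ∈ towerBondsP L (cubeFam true L a M ρ k) (Λs k) p.1} =>
                  linCovIter L U₀ (iEta η A') p.1.1 p.1.2.1 p.1.2.2)) ∧
          bondNorm L k η (-(3 : ℝ)) (cubeFam true L a M ρ k) (fun x μ => covLap η U₀ (fun z => A' z μ) x)
            ≤ B₀ * (bondNorm L k η (-(3 : ℝ)) (cubeFam true L a M ρ k) (fun x μ => Jcur η U₀ A' μ x)
              + wsup 1 (fun p : {p : ℕ × (Site d × Fin d) // p.1 ≤ k ∧ p.2 ∈ towerBondsP L (cubeFam true L a M ρ k) (Λs k) p.1} =>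
                  linCovIter L U₀ (iEta η A') p.1.1 p.1.2.1 p.1.2.2)) ∧
          msup L k η (-(2 + β)) memH (fun q => hquot η β len U₀ (covDerivFwd η U₀ q.1 (fun z => A' z q.2.1)) q.2.2)
            ≤ B₀β * (bondNorm L k η (-(3 : ℝ)) (cubeFam true L a M ρ k) (fun x μ => Jcur η U₀ A' μ x)
              + wsup 1 (fun p : {p : ℕ × (Site d × Fin d) // p.1 ≤ k ∧ p.2 ∈ towerBondsP L (cubeFam true L a M ρ k) (Λs k) p.1} =>
                  linCovIter L U₀ (iEta η A') p.1.1 p.1.2.1 p.1.2.2)) := by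
  classical
  obtain ⟨α₀, B'', hα₀, hB'', H⟩ := exists_curved159_perCube_inAk_sup_unitary_uniform (𝔹 := 𝔹) hd2 hL2 M hρ (k := k) (m := k) hk le_rfl
  have hL1 : 1 ≤ L := le_trans (by norm_num) hL2
  have hρ1 : 1 ≤ ρ := hL1.trans hρ
  have hL1r : (1 : ℝ) ≤ L := by exact_mod_cast hL1
  have hLk1 : (1 : ℝ) ≤ (L : ℝ) ^ k := one_le_pow₀ hL1r
  have hd1 : (1 : ℝ) ≤ d := by exact_mod_cast (le_trans (by norm_num) hd2 : 1 ≤ d)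
  set P₀ : ℝ := B'' + 1 with hP₀
  have hP₀0 : 0 < P₀ := by positivity
  have hBP : B'' ≤ P₀ := by linarith
  refine ⟨4 * ((d : ℝ) + 1) * ((L : ℝ) ^ k) ^ 3 * P₀, 4 * ((L : ℝ) ^ k) ^ 2 * ((L : ℝ) ^ k) ^ β * P₀, min α₀ (1 / 2),
    by positivity, by positivity, lt_min hα₀ (by norm_num), ?_⟩
  intro a η hη Λs hΛ0 hΛ memH hmemH α₀' α₂ hα₀' hα₀'c hα₂ hα₂c U₀ W hU₀ _hW hAk _hAkW hLanW A' _hsa h41 _hA0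
  have hU1 : ∀ x κ, U₀ x κ ∈ U1 𝔹 := fun x κ => unitaryUnits_le_U1 (hU₀ x κ)
  have hST0 : ∀ (y : Site d) (τ : Fin d), SideTouches (cubeFam true L a M ρ k 0) y τ := fun y τ => by
    obtain ⟨κ, hκ⟩ := exists_ne_fin hd2 τ
    rw [cubeFam_true_zero]
    exact sideTouches_of_bondTouches hκ (Or.inl (Set.mem_univ y))
  have hAb : ∀ (y : Site d) (τ : Fin d), ‖A' y τ‖ ≤ α₂ * η⁻¹ := fun y τ => by
    have h := (h41 0 (Nat.zero_le k) y τ (hST0 y τ)).2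
    rwa [pow_zero, one_mul] at h
  have hα₂η : 0 ≤ α₂ * η⁻¹ := by positivity
  have hWexp : W = cfgExp η A' := funext fun y => funext fun τ => (h41 0 (Nat.zero_le k) y τ (hST0 y τ)).1
  have hlog : logCfg η W = A' := by
    rw [hWexp]
    refine logCfg_cfgExp_of_small hη fun y τ => ?_
    have h1 : η * ‖A' y τ‖ ≤ α₂ := by
      calc η * ‖A' y τ‖ ≤ η * (α₂ * η⁻¹) := mul_le_mul_of_nonneg_left (hAb y τ) hη.le
        _ = α₂ := by field_simp
    have h2 : α₂ ≤ 1 / 2 := hα₂c.trans (min_le_right _ _)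
    linarith [Real.log_two_gt_d9]
  have hLanA : IsLandau138 L k η (Set.univ : Set (Site d)) (Λs k) U₀ A' := by
    have h := hLanW
    unfold IsLandau138W at h
    rwa [hlog, cubeFam_true_zero] at h
  set φ : Site d → Fin d → 𝔹 := fun y τ => if SideTouches (cube L a M ρ k 0) y τ then A' y τ else 0 with hφ
  have hφS : ∀ (y : Site d) (τ : Fin d), SideTouches (cube L a M ρ k 0) y τ → φ y τ = A' y τ := fun y τ hs => by
    show (if SideTouches (cube L a M ρ k 0) y τ then A' y τ else 0) = A' y τ
    rw [if_pos hs]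
  have hφN : ∀ (y : Site d) (τ : Fin d), ¬ SideTouches (cube L a M ρ k 0) y τ → φ y τ = 0 := fun y τ hs => by
    show (if SideTouches (cube L a M ρ k 0) y τ then A' y τ else 0) = 0
    rw [if_neg hs]
  have hφA : ∀ (y : Site d) (τ : Fin d), BondTouches (cube L a M ρ k 0) y τ → φ y τ = A' y τ := fun y τ hb => by
    obtain ⟨κ, hκ⟩ := exists_ne_fin hd2 τ
    exact hφS y τ (sideTouches_of_bondTouches hκ hb)
  have hLanφ : IsLandau138 L k η (cubeFam false L a M ρ k 0) (cubeLamS L a M ρ k k) U₀ φ :=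
    isLandau138_cube_of_univ hL1 a M hρ1 hk hΛ0 hΛ hφA hLanA
  have hφ0 : ∀ (y : Site d) (τ : Fin d), (∀ j, j ≤ k → ¬ SideTouches (cubeFam false L a M ρ k j) y τ) → φ y τ = 0 := fun y τ h =>
    hφN y τ (by have h0 := h 0 (Nat.zero_le k); rwa [cubeFam_false_zero] at h0)
  have hAk0 : InAk L k η α₀ (cubeFam true L a M ρ k) U₀ := inAk_mono_alpha hη (hα₀'c.trans (min_le_left _ _)) hAk
  have hsub : cubeFam false L a M ρ k 0 ⊆ cubeFam true L a M ρ k 0 := by rw [cubeFam_true_zero]; exact Set.subset_univ _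
  set N : ℝ := bondNorm L k η (-(3 : ℝ)) (cubeFam true L a M ρ k) (fun x μ => Jcur η U₀ A' μ x) +
    wsup 1 (fun p : {p : ℕ × (Site d × Fin d) // p.1 ≤ k ∧ p.2 ∈ towerBondsP L (cubeFam true L a M ρ k) (Λs k) p.1} =>
      linCovIter L U₀ (iEta η A') p.1.1 p.1.2.1 p.1.2.2) with hN
  have hN0 : 0 ≤ N := add_nonneg (msup_nonneg L k hη.le _ _ _) (wsup_nonneg zero_le_one _)
  have hBJ := bdd_Jcur_of_bound hL1 hη hU1 k (cubeFam true L a M ρ k) hα₂η hAb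
  have hiEta : ∀ (y : Site d) (τ : Fin d), ‖iEta η A' y τ‖ ≤ η * (α₂ * η⁻¹) := fun y τ => B8Eq146AExpansion.norm_iEta_le hη.le hAb y τ
  obtain ⟨Cavg, hCavg⟩ := exists_bound_linCovIter_towerBondsP (U₀ := U₀) L a M ρ k (Λ := Λs k) hΛ hiEta
  have hNJ : ∀ j, j ≤ k → ∀ (x : Site d) (μ : Fin d), BondTouches (cubeFam true L a M ρ k j) x μ →
      ((L : ℝ) ^ j * η) ^ 3 * ‖Jcur η U₀ A' μ x‖ ≤ N := by
    intro j hj x μ hb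
    have h := weight_mul_norm_le_msup hBJ hj (i := (x, μ)) hb
    have e3 : (-(3 : ℝ)) = -((3 : ℕ) : ℝ) := by norm_num
    rw [e3, weight_neg_natCast] at h
    exact h.trans (le_add_of_nonneg_right (wsup_nonneg zero_le_one _))
  have hNavg : ∀ j, j ≤ k → ∀ c ∈ towerBondsP L (cubeFam true L a M ρ k) (Λs k) j, ‖linCovIter L U₀ (iEta η A') j c.1 c.2‖ ≤ N := by
    intro j hj c hc
    have h := le_wsup hCavg ⟨(j, c), hj, hc⟩
    rw [one_mul] at h
    exact h.trans (le_add_of_nonneg_left (msup_nonneg L k hη.le _ _ _))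
  have HJ : ∀ j, j ≤ k → ∀ (y : Site d) (τ : Fin d), BondTouches (cubeFam false L a M ρ k j) y τ →
      ((L : ℝ) ^ j * η) ^ 3 * ‖Jcur η U₀ φ τ y‖ ≤ N := by
    intro j hj y τ hb
    rw [cubeFam_false_of_le L a M ρ hj] at hb
    have hb0 : BondTouches (cube L a M ρ k 0) y τ := by
      rcases hb with h | h
      exacts [Or.inl (cube_anti (Nat.zero_le j) hj h), Or.inr (cube_anti (Nat.zero_le j) hj h)]
    rw [Jcur_congr_fld_touch hb0 hφS]
    refine hNJ j hj y τ ?_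
    rcases Nat.eq_zero_or_pos j with rfl | hj1
    · rw [cubeFam_true_zero]; exact Or.inl (Set.mem_univ y)
    · rwa [cubeFam_of_pos true L a M ρ hj1 hj]
  have Havg : ∀ j, j ≤ k → ∀ c ∈ cubeLamBP L a M ρ k k j, ‖linCovIter L U₀ (iEta η φ) j c.1 c.2‖ ≤ N := by
    intro j hj c hc
    rcases Nat.eq_zero_or_pos j with rfl | hj1
    · -- level `0`: the average is the field itself, the class bond touches `□₀`
      have hb0 : BondTouches (cube L a M ρ k 0) c.1 c.2 := by
        obtain ⟨-, hends, -⟩ := hc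
        exact hends
      have e0 : linCovIter L U₀ (iEta η φ) 0 c.1 c.2 = linCovIter L U₀ (iEta η A') 0 c.1 c.2 := by
        show iEta η φ c.1 c.2 = iEta η A' c.1 c.2
        simp only [iEta, hφA c.1 c.2 hb0]
      rw [e0]
      exact hNavg 0 hj c (cubeLamBP_zero_subset_towerBondsP hL1 a M ρ hk hΛ0 hc)
    · have hjk : j - 1 ≤ k := by omega
      have e1 : linCovIter L U₀ (iEta η φ) j c.1 c.2 = linCovIter L U₀ (iEta η A') j c.1 c.2 :=
        linCovIter_congr L hL1 j c.1 c.2 (fun _ _ _ _ => rfl) fun z κ hz _ => by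
          simp only [iEta, hφA z κ (Or.inl (cube_anti (Nat.zero_le _) hjk (cubeLamBP_box_subset_pred hL1 a M hρ hj1 le_rfl hc z hz)))]
      rw [e1]
      exact hNavg j hj c (cubeLamBP_subset_towerBondsP_topCube_of_le hL1 a M hρ hΛ0 hΛ hj1 hj hc)
  have Hout : ∀ (y : Site d) (τ : Fin d), ¬ BondTouches (cubeFam false L a M ρ k 0) y τ → η * ‖φ y τ‖ ≤ N := by
    intro y τ hnb
    rw [cubeFam_false_zero] at hnb
    by_cases hs : SideTouches (cube L a M ρ k 0) y τ
    · rw [hφS y τ hs, ← norm_I_eta_smul hη.le]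
      exact hNavg 0 (Nat.zero_le k) (y, τ) (mem_towerBondsP_zero_of_not_bondTouches L a M ρ hk hΛ0 hnb)
    · rw [hφN y τ hs, norm_zero, mul_zero]; exact hN0
  have hmain := H a η hη U₀ hU₀ (cubeFam true L a M ρ k) k hsub hAk0 φ hLanφ hφ0 N hN0 HJ Havg Hout
  have POINT : ∀ (y : Site d) (τ : Fin d), η * ‖A' y τ‖ ≤ P₀ * N := by
    intro y τ
    by_cases hb1 : BondTouches (cube L a M ρ k 1) y τ
    · -- a bond touching `□₁`: file (U)'s line (i) at level `1`
      obtain ⟨κ, hκ⟩ := exists_ne_fin hd2 τ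
      have hs1 : SideTouches (cubeFam false L a M ρ k 1) y τ := by
        rw [cubeFam_false_of_le L a M ρ hk]; exact sideTouches_of_bondTouches hκ hb1
      have h := (hmain 1 hk y τ hs1).1
      have hs0 : SideTouches (cube L a M ρ k 0) y τ :=
        sideTouches_mono (cube_anti (Nat.zero_le 1) hk) (sideTouches_of_bondTouches hκ hb1)
      rw [hφS y τ hs0, pow_one] at h
      calc η * ‖A' y τ‖ ≤ (L : ℝ) * η * ‖A' y τ‖ := by
            rw [mul_assoc]; exact le_mul_of_one_le_left (by positivity) hL1r
        _ ≤ B'' * N := h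
        _ ≤ P₀ * N := mul_le_mul_of_nonneg_right hBP hN0
    · -- both end-points off `□₁`: a level-`0` bond of print's class, read by `|B₁|`
      have h1 : y ∉ cube L a M ρ k 1 := fun h => hb1 (Or.inl h)
      have h2 : y + e τ ∉ cube L a M ρ k 1 := fun h => hb1 (Or.inr h)
      have h := hNavg 0 (Nat.zero_le k) (y, τ) (mem_towerBondsP_zero_of_ends L a M ρ k hΛ0 h1 h2)
      have e0 : linCovIter L U₀ (iEta η A') 0 (y, τ).1 (y, τ).2 = ((Complex.I : ℂ) * η) • A' y τ := rfl
      rw [e0, norm_I_eta_smul hη.le] at h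
      exact h.trans (le_mul_of_one_le_left hN0 (by linarith))
  have POINT' : ∀ (y : Site d) (τ : Fin d), ‖A' y τ‖ ≤ P₀ * N * η⁻¹ := fun y τ => by
    rw [le_mul_inv_iff₀ hη, mul_comm]; exact POINT y τ
  have hB1 : P₀ ≤ 4 * ((d : ℝ) + 1) * ((L : ℝ) ^ k) ^ 3 * P₀ := by
    have : (1 : ℝ) ≤ 4 * ((d : ℝ) + 1) * ((L : ℝ) ^ k) ^ 3 := by nlinarith [one_le_pow₀ (n := 3) hLk1]
    nlinarith
  have hB2 : 2 * ((L : ℝ) ^ k) ^ 2 * P₀ ≤ 4 * ((d : ℝ) + 1) * ((L : ℝ) ^ k) ^ 3 * P₀ :=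
    mul_le_mul_of_nonneg_right ((mul_le_mul_of_nonneg_left (pow_le_pow_right₀ hLk1 (by norm_num : 2 ≤ 3)) (by norm_num)).trans
      (mul_le_mul_of_nonneg_right (by linarith) (by positivity))) hP₀0.le
  have hB4 : 4 * (d : ℝ) * ((L : ℝ) ^ k) ^ 3 * P₀ ≤ 4 * ((d : ℝ) + 1) * ((L : ℝ) ^ k) ^ 3 * P₀ := by nlinarith [one_le_pow₀ (n := 3) hLk1]
  have hB3 : (1 : ℝ) ≤ 4 * ((d : ℝ) + 1) * ((L : ℝ) ^ k) ^ 3 * P₀ := le_trans (by linarith) hB1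
  have hLj : ∀ j, j ≤ k → (L : ℝ) ^ j ≤ (L : ℝ) ^ k := fun j hj => pow_le_pow_right₀ hL1r hj
  refine ⟨?_, ?_, ?_, ?_, ?_⟩
  · -- LINE 1: `|A′|₍₋₁₎ ≤ B₀·N`
    refine msup_le (by positivity) fun j hj b hb => ?_
    have e1 : (-(1 : ℝ)) = -((1 : ℕ) : ℝ) := by norm_num
    rw [e1, weight_neg_natCast, pow_one]
    rcases Nat.eq_zero_or_pos j with rfl | hj1
    · rw [pow_zero, one_mul]
      exact (POINT b.1 b.2).trans (mul_le_mul_of_nonneg_right hB1 hN0)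
    · rw [cubeFam_of_pos true L a M ρ hj1 hj] at hb
      have hs : SideTouches (cubeFam false L a M ρ k j) b.1 b.2 := by rwa [cubeFam_false_of_le L a M ρ hj]
      have h := (hmain j hj b.1 b.2 hs).1
      rw [hφS b.1 b.2 (sideTouches_mono (cube_anti (Nat.zero_le j) hj) hb)] at h
      exact h.trans (mul_le_mul_of_nonneg_right (hBP.trans hB1) hN0)
  · -- LINE 2: `|∇A′|₍₋₂₎ ≤ B₀·N` from the pointwise bound
    refine msup_le (by positivity) fun j hj t _ => ?_
    have e2 : (-(2 : ℝ)) = -((2 : ℕ) : ℝ) := by norm_num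
    rw [e2, weight_neg_natCast]
    have hD := B8Ineq159StencilsNearFlat.norm_covDerivFwd_le hU1 hη t.1 (fun z => A' z t.2.1) t.2.2
    calc ((L : ℝ) ^ j * η) ^ 2 * ‖covDerivFwd η U₀ t.1 (fun z => A' z t.2.1) t.2.2‖
        ≤ ((L : ℝ) ^ k * η) ^ 2 * (η⁻¹ * (‖A' (t.2.2 + e t.1) t.2.1‖ + ‖A' t.2.2 t.2.1‖)) :=
          mul_le_mul (pow_le_pow_left₀ (by positivity) (mul_le_mul_of_nonneg_right (hLj j hj) hη.le) 2) hD (norm_nonneg _) (by positivity)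
      _ = ((L : ℝ) ^ k) ^ 2 * (η * ‖A' (t.2.2 + e t.1) t.2.1‖ + η * ‖A' t.2.2 t.2.1‖) := by field_simp
      _ ≤ ((L : ℝ) ^ k) ^ 2 * (P₀ * N + P₀ * N) := mul_le_mul_of_nonneg_left (add_le_add (POINT _ _) (POINT _ _)) (by positivity)
      _ = 2 * ((L : ℝ) ^ k) ^ 2 * P₀ * N := by ring
      _ ≤ 4 * ((d : ℝ) + 1) * ((L : ℝ) ^ k) ^ 3 * P₀ * N := mul_le_mul_of_nonneg_right hB2 hN0
  · -- LINE 3: `|D^{η*}D^η A′|₍₋₃₎ = |J|₍₋₃₎ ≤ N ≤ B₀·N`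
    calc bondNorm L k η (-(3 : ℝ)) (cubeFam true L a M ρ k) (fun x μ => pdiv η U₀ (plaqCovDeriv η U₀ A') μ x)
        = bondNorm L k η (-(3 : ℝ)) (cubeFam true L a M ρ k) (fun x μ => Jcur η U₀ A' μ x) := rfl
      _ ≤ N := le_add_of_nonneg_right (wsup_nonneg zero_le_one _)
      _ ≤ 4 * ((d : ℝ) + 1) * ((L : ℝ) ^ k) ^ 3 * P₀ * N := le_mul_of_one_le_left hN0 hB3
  · -- LINE 4: `|Δ^η_{U₀}A′|₍₋₃₎ ≤ B₀·N` from the pointwise bound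
    refine msup_le (by positivity) fun j hj b _ => ?_
    have e3 : (-(3 : ℝ)) = -((3 : ℕ) : ℝ) := by norm_num
    rw [e3, weight_neg_natCast]
    have hC := B8Ineq159StencilsNearFlat.norm_covLap_le hU1 hη (g := fun z => A' z b.2) (fun z => POINT' z b.2) b.1
    calc ((L : ℝ) ^ j * η) ^ 3 * ‖covLap η U₀ (fun z => A' z b.2) b.1‖
        ≤ ((L : ℝ) ^ k * η) ^ 3 * (4 * d * (η ^ 2)⁻¹ * (P₀ * N * η⁻¹)) :=
          mul_le_mul (pow_le_pow_left₀ (by positivity) (mul_le_mul_of_nonneg_right (hLj j hj) hη.le) 3) hC (norm_nonneg _) (by positivity)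
      _ = 4 * d * ((L : ℝ) ^ k) ^ 3 * P₀ * N := by field_simp
      _ ≤ 4 * ((d : ℝ) + 1) * ((L : ℝ) ^ k) ^ 3 * P₀ * N := mul_le_mul_of_nonneg_right hB4 hN0
  · -- LINE 5: the both-points Hölder line from the pointwise derivative bound
    refine msup_le (by positivity) fun j hj q hq => ?_
    have hp := hmemH j q hq
    have hD : ∀ z, η ^ 2 * ‖covDerivFwd η U₀ q.1 (fun w => A' w q.2.1) z‖ ≤ 2 * P₀ * N := by
      intro z
      have h := B8Ineq159StencilsNearFlat.norm_covDerivFwd_le hU1 hη q.1 (fun w => A' w q.2.1) z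
      calc η ^ 2 * ‖covDerivFwd η U₀ q.1 (fun w => A' w q.2.1) z‖ ≤ η ^ 2 * (η⁻¹ * (‖A' (z + e q.1) q.2.1‖ + ‖A' z q.2.1‖)) :=
            mul_le_mul_of_nonneg_left h (by positivity)
        _ = η * ‖A' (z + e q.1) q.2.1‖ + η * ‖A' z q.2.1‖ := by field_simp
        _ ≤ P₀ * N + P₀ * N := add_le_add (POINT _ _) (POINT _ _)
        _ = 2 * P₀ * N := by ring
    have h := weight_mul_hquot_le hL1 hη hβ hlen hU1 (by positivity) hD hj (x := q.2.2.1) (x' := q.2.2.2) hp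
    calc weight L η (-(2 + β)) j * ‖hquot η β len U₀ (covDerivFwd η U₀ q.1 fun w => A' w q.2.1) q.2.2‖
        ≤ 2 * ((L : ℝ) ^ k) ^ 2 * ((L : ℝ) ^ k) ^ β * (2 * P₀ * N) := h
      _ = 4 * ((L : ℝ) ^ k) ^ 2 * ((L : ℝ) ^ k) ^ β * P₀ * N := by ring

/-! ## §3 The two sockets of Proposition 3's frame at the top-cube tower -/

/-- ★★★ **THE b9-SOCKET `SockB9P3H2` OF PROPOSITION 3's FRAME (the `SB9P` binder's shape of the P₂D slot) HOLDS AT PRINT'S TOP-CUBE TOWER WITH THE PRINTED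
CLASS `towerBondsP`, PER MEMBER**: `∃ B₀ B₀β cP > 0` (shape-dependent) before `∀ a η Λs` of print's shape, the five lines of (1.59) — `|A′|₍₋₁₎, |∇A′|₍₋₂₎, |D*D A′|₍₋₃₎,
|ΔA′|₍₋₃₎ ≤ B₀(|J|₍₋₃₎ + |B₁|)` and the both-points Hölder line — for unitary `U₀ ∈ 𝔄_k((T, □_j), α₀)`, `W = e^{iηA′}` in the Landau gauge (1.38) of `U₀`,
`|A′| ≤ α₂(Lʲη)⁻¹`, `α₀, α₂ ≤ cP`.  NOT [4] Thm 3.3's uniform `B₀(d, L)`. [cite: Balaban1985RegularSpaces, (1.57)–(1.59) p.86, (1.38) p.82, (1.31) p.82, (1.131) p.99, (1.7) p.77; Balaban1985BackgroundPropagators, Thm 3.3 p.399, (3.43), (3.47) p.398; Balaban1984PropagatorsII, (2.3) p.224] -/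
theorem exists_sockB9P3H2_topCube [FiniteDimensional ℂ 𝔹] (hd2 : 2 ≤ d) {L : ℕ} (hL2 : 2 ≤ L) (M : ℕ) {ρ : ℕ} (hρ : L ≤ ρ)
    {k : ℕ} (hk : 1 ≤ k) {β : ℝ} (hβ : 0 ≤ β) {len : Site d → ℝ} (hlen : ∀ z : Site d, z ≠ 0 → 1 ≤ len z) :
    ∃ B₀ B₀β cP : ℝ, 0 < B₀ ∧ 0 < B₀β ∧ 0 < cP ∧ ∀ (a : Site d) (η : ℝ), 0 < η →
      ∀ Λs : ℕ → ℕ → Set (Site d), Λs k 0 = (cube L a M ρ k 1)ᶜ → (∀ j, 1 ≤ j → j ≤ k → Λs k j = cubeLamS L a M ρ k k j) →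
        SockB9P3H2 (𝔸 := 𝔹) L B₀ B₀β cP β len η k (cubeFam true L a M ρ k) Λs
          (fun m j => towerBondsP L (cubeFam true L a M ρ k) (Λs m) j) := by
  obtain ⟨B₀, B₀β, cP, hB₀, hB₀β, hcP, H⟩ := socketLines_topCube (𝔹 := 𝔹) hd2 hL2 M hρ hk hβ hlen
  exact ⟨B₀, B₀β, cP, hB₀, hB₀β, hcP, fun a η hη Λs hΛ0 hΛ =>
    H a η hη Λs hΛ0 hΛ (fun j q => q.2.2 ∈ AdmPair η len ∧ q.2.2.1 ∈ cubeFam true L a M ρ k j ∧ q.2.2.2 ∈ cubeFam true L a M ρ k j)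
      fun _ _ hq => hq.1⟩

/-- ★★★ **THE SOCKET `SockB9P3` (Hölder pairs with the first point in `Ω_j`) ALSO HOLDS AT THE TOP-CUBE TOWER WITH `towerBondsP`, PER MEMBER** — the LITERAL positive
twin of `B8SockB9P3ShellModeVacuityUniv.not_sockB9P3_of_topCube` (there: `Λb 1 = towerBonds`, law №12 without crossing bonds ⇒ `¬ SockB9P3 …` for every `B₀ B₀β cP`;
here: `Λb = towerBondsP`, print's (1.31) ⇒ `SockB9P3 …` for SOME `B₀ B₀β cP`, every depth `k ≥ 1`). [cite: Balaban1985RegularSpaces, (1.57)–(1.59) p.86, (1.31) p.82, (1.131) p.99; Balaban1985BackgroundPropagators, Thm 3.3 p.399, (3.47) p.398; Balaban1984PropagatorsII, (2.3) p.224] -/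
theorem exists_sockB9P3_topCube [FiniteDimensional ℂ 𝔹] (hd2 : 2 ≤ d) {L : ℕ} (hL2 : 2 ≤ L) (M : ℕ) {ρ : ℕ} (hρ : L ≤ ρ)
    {k : ℕ} (hk : 1 ≤ k) {β : ℝ} (hβ : 0 ≤ β) {len : Site d → ℝ} (hlen : ∀ z : Site d, z ≠ 0 → 1 ≤ len z) :
    ∃ B₀ B₀β cP : ℝ, 0 < B₀ ∧ 0 < B₀β ∧ 0 < cP ∧ ∀ (a : Site d) (η : ℝ), 0 < η →
      ∀ Λs : ℕ → ℕ → Set (Site d), Λs k 0 = (cube L a M ρ k 1)ᶜ → (∀ j, 1 ≤ j → j ≤ k → Λs k j = cubeLamS L a M ρ k k j) →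
        SockB9P3 (𝔸 := 𝔹) L B₀ B₀β cP β len η k (cubeFam true L a M ρ k) Λs
          (fun m j => towerBondsP L (cubeFam true L a M ρ k) (Λs m) j) := by
  obtain ⟨B₀, B₀β, cP, hB₀, hB₀β, hcP, H⟩ := socketLines_topCube (𝔹 := 𝔹) hd2 hL2 M hρ hk hβ hlen
  exact ⟨B₀, B₀β, cP, hB₀, hB₀β, hcP, fun a η hη Λs hΛ0 hΛ =>
    H a η hη Λs hΛ0 hΛ (fun j q => q.2.2 ∈ AdmPair η len ∧ q.2.2.1 ∈ cubeFam true L a M ρ k j) fun _ _ hq => hq.1⟩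

end Literature.MathematicalPhysics.QuantumFieldTheory.Balaban1983to89.B8SockB9P3H2AtTopCubeTower

end
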